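import Literature.Geometry.Lorentzian.GaussianBeamTube
import Literature.Geometry.Lorentzian.KerrSchildWaveCauchyReduction
import HarnessLib

/-!
# The real Gaussian beam is an approximate solution: the slab norm of `□ Re(a e^{iλφ})`
(trunk G08 = T-LORENTZ, geometric optics; namespace `Literature.Geometry.Lorentzian.GaussianBeam`)

Sbierski, Anal. PDE 8 (2015), §3, second lemma (= arXiv:1311.2477 Lemma 5, p. 14) and §2, proof of
Thm. 2.1, first condition: `‖□u_λ‖_{L²(R_{[0,T]})} ≤ C(T)` uniformly in `λ ≥ 1` (before the
normalisation `ũ = u/√E₀`, `E₀ ∼ √λ`, which makes it tend to zero). For the explicit real beam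
`Re(a e^{iλφ})` of an admissible amplitude over beam data (`BeamAmp`) in a chart with the
divergence-form wave operator `KerrSchild.waveOperator G` this file proves

* `BeamAmp.abs_waveOperator_beam_le` — the pointwise bound
  `|□_G Re(a e^{iλφ})(t,y)| ≤ e^{−λc₀‖y−c(t)‖²}(λ² D₁ ‖y−c‖³ + λ D₂ ‖y−c‖ + D₃)` over `0 ≤ t ≤ T`
  (WKB identity `KerrSchild.abs_waveOperator_re_beam_le`, the flat eikonal/transport bounds of
  `GaussianBeamErrors`, `Im φ ≥ c₀‖y−c‖²`);
* **`BeamAmp.exists_slab_sq_waveOperator_le`** — `∫_{[0,T]×E3} (□_G Re(a e^{iλφ}))² ≤ C` for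
  all `λ ≥ 1` (`GaussianDamping.exists_slab_sq_le_of_beam_bound`, `dim = 3 ≥ 2`).

## References

* J. Sbierski, Anal. PDE 8 (2015) 1379–1420, §3 (second lemma), §2 (proof of Thm. 2.1, (2.4));
  arXiv:1311.2477v2 Lemma 5 p. 14, (2.4)–(2.6) (key `Sbierski2015`).
-/

noncomputable section

open Set Filter Complex MeasureTheory Metric
open scoped ContDiff Topology

namespace Literature.Geometry.Lorentzian

namespace GaussianBeam

open KerrSchild Literature.Analysis.Asymptotics.GaussianBeam

namespace BeamAmp

variable {G : E4 → Fin 4 → Fin 4 → ℝ} {V : Set E4} {J : Set ℝ} {D : BeamData G V J} {T : ℝ}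
  (A : BeamAmp D T)

/-- On the slab the complex symbol of `dφ` is the eikonal defect. [folklore] -/
theorem _root_.Literature.Geometry.Lorentzian.GaussianBeam.BeamData.symbolC_dC_φ (D : BeamData G V J)
    {x : E4} (hx : x 0 ∈ J) : symbolC G x (dC D.φ x) (dC D.φ x) = defect G D.P D.M D.c x := by
  rw [BeamData.φ]; exact symbolC_phase G D.P D.M D.c D.hJ D.hP D.hM D.hc hx

/-- **Pointwise bound for `□_G` of the real beam over `[0, T]`**:
`|□_G Re(a e^{iλφ})(t, y)| ≤ e^{−λc₀‖y−c(t)‖²} (λ² D₁ ‖y−c(t)‖³ + λ D₂ ‖y−c(t)‖ + D₃)` for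
`λ ≥ 0`, with the constants of the flat eikonal and transport bounds and of `□a`.
[cite: Sbierski2015, §3 (second lemma, proof: the three terms of `□(a e^{iλφ})`)] -/
theorem abs_waveOperator_beam_le : ∃ D₁ D₂ D₃ c₀ : ℝ, 0 ≤ D₁ ∧ 0 ≤ D₂ ∧ 0 ≤ D₃ ∧ 0 < c₀ ∧
    ∀ lam : ℝ, 0 ≤ lam → ∀ t ∈ Icc (0 : ℝ) T, ∀ y : E3,
      |waveOperator G (A.beam lam) (E4.ofTimeSpace t y)| ≤
        Real.exp (-(lam * c₀ * ‖y - D.c t‖ ^ 2)) *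
          (lam ^ 2 * D₁ * ‖y - D.c t‖ ^ 3 + lam * D₂ * ‖y - D.c t‖ + D₃) := by
  obtain ⟨D₁, hD₁, hEik⟩ := A.exists_eik_bound
  obtain ⟨D₂, hD₂, hTr⟩ := A.exists_tr_bound
  obtain ⟨D₃, hD₃, hBox⟩ := A.exists_box_amp_bound
  obtain ⟨c₀, hc₀, hIm⟩ := A.exists_pos_le_im_φ
  refine ⟨D₁, D₂, D₃, c₀, hD₁, hD₂, hD₃, hc₀, fun lam hlam t ht y ↦ ?_⟩
  set x := E4.ofTimeSpace t y with hx
  have htJ : t ∈ J := A.Icc_subset ht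
  have htH : t ∈ A.timeHull := A.Icc_subset_timeHull ht
  have hxJ : x 0 ∈ J := by simpa [hx] using htJ
  have hRHS : 0 ≤ Real.exp (-(lam * c₀ * ‖y - D.c t‖ ^ 2)) *
      (lam ^ 2 * D₁ * ‖y - D.c t‖ ^ 3 + lam * D₂ * ‖y - D.c t‖ + D₃) := by positivity
  by_cases hxs : x ∈ tsupport A.amp
  · have hxV : x ∈ V := A.tsupp_V hxs
    have hG : ∀ μ ν, DifferentiableAt ℝ (fun z ↦ G z μ ν) x := fun μ ν ↦
      ((D.hG μ ν).contDiffAt (D.hV.mem_nhds hxV)).differentiableAt (by simp)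
    have ha : ContDiffAt ℝ 2 A.amp x := A.smooth.contDiffAt.of_le ENat.LEInfty.out
    have hφ : ContDiffAt ℝ 2 D.φ x :=
      (D.contDiffOn_φ.contDiffAt ((isOpen_slab D.hJ).mem_nhds hxJ)).of_le ENat.LEInfty.out
    have hfun : A.beam lam = fun z ↦ (A.amp z * cexp (I * lam * D.φ z)).re := rfl
    have h := abs_waveOperator_re_beam_le lam hG (D.hGsymm x) ha hφ
    rw [← hfun] at h
    refine h.trans ?_
    -- the weight
    have hw : Real.exp (-(lam * (D.φ x).im)) ≤ Real.exp (-(lam * c₀ * ‖y - D.c t‖ ^ 2)) := by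
      have him := hIm x (by simpa [hx] using htH)
      simp only [hx, E4.spatial_ofTimeSpace, E4.ofTimeSpace_apply_zero] at him
      apply Real.exp_le_exp.2
      nlinarith
    -- the three terms
    have h1 : lam ^ 2 * ‖A.amp x‖ * ‖symbolC G x (dC D.φ x) (dC D.φ x)‖ ≤ lam ^ 2 * D₁ * ‖y - D.c t‖ ^ 3 := by
      rw [D.symbolC_dC_φ hxJ, mul_assoc, ← norm_mul]
      exact (mul_le_mul_of_nonneg_left (hEik t htH y) (by positivity)).trans (le_of_eq (by ring))
    have h2 : |lam| * ‖2 * symbolC G x (dC D.φ x) (dC A.amp x) + A.amp x * waveOperatorC G D.φ x‖ ≤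
        lam * D₂ * ‖y - D.c t‖ := by
      rw [abs_of_nonneg hlam, mul_assoc]
      exact mul_le_mul_of_nonneg_left (hTr t ht y) hlam
    have h3 : ‖waveOperatorC G A.amp x‖ ≤ D₃ := hBox x
    have hsum : lam ^ 2 * ‖A.amp x‖ * ‖symbolC G x (dC D.φ x) (dC D.φ x)‖ +
        |lam| * ‖2 * symbolC G x (dC D.φ x) (dC A.amp x) + A.amp x * waveOperatorC G D.φ x‖ +
        ‖waveOperatorC G A.amp x‖ ≤ lam ^ 2 * D₁ * ‖y - D.c t‖ ^ 3 + lam * D₂ * ‖y - D.c t‖ + D₃ :=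
      add_le_add (add_le_add h1 h2) h3
    exact mul_le_mul hw hsum (by positivity) (Real.exp_nonneg _)
  · have hzero : A.beam lam =ᶠ[𝓝 x] 0 := by
      filter_upwards [(isClosed_tsupport A.amp).isOpen_compl.mem_nhds hxs] with z hz
      simp [A.beam_apply, image_eq_zero_of_notMem_tsupport hz]
    rw [waveOperator_eq_zero_of_eventuallyEq_zero hzero, abs_zero]
    exact hRHS

/-- **The slab norm of `□_G` of the real beam is bounded uniformly in `λ ≥ 1`**:
`∫_{[0,T]×E3} (□_G Re(a e^{iλφ}))² ≤ C` ("`‖□u_λ‖_{L²(R_{[0,T]})} ≤ C(T)`", the beam being an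
approximate solution before normalisation). [cite: Sbierski2015, §3 (second lemma) and §2 (proof of Thm. 2.1, (2.4))] -/
theorem exists_slab_sq_waveOperator_le : ∃ C : ℝ, 0 ≤ C ∧ ∀ lam : ℝ, 1 ≤ lam →
    ∫ p in Icc (0 : ℝ) T ×ˢ (univ : Set E3),
      waveOperator G (A.beam lam) (E4.ofTimeSpace p.1 p.2) ^ 2 ≤ C := by
  obtain ⟨D₁, D₂, D₃, c₀, _, _, _, hc₀, hpt⟩ := A.abs_waveOperator_beam_le
  obtain ⟨C, hC0, hC⟩ :=
    exists_slab_sq_le_of_beam_bound A.ce A.contDiff_ce.continuous D₁ D₂ D₃ hc₀ T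
  refine ⟨C, hC0, fun lam hlam ↦ ?_⟩
  have hd : 2 ≤ Module.finrank ℝ E3 := by rw [finrank_euclideanSpace_fin]; norm_num
  refine (hC lam hlam (fun p ↦ waveOperator G (A.beam lam) (E4.ofTimeSpace p.1 p.2)) ?_).2 hd
  intro p hp
  have ht : p.1 ∈ Icc (0 : ℝ) T := hp.1
  rw [A.ce_eq (A.Icc_subset_timeHull ht)]
  exact hpt lam (by linarith) p.1 ht p.2

end BeamAmp

/-! ### Scaling and continuity of the chart quantities for compactly supported smooth functions -/

/-- **The wave operator is continuous** for `w ∈ C^∞` supported inside the open set where the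
coefficients are smooth. [folklore] -/
theorem continuous_waveOperator_of_tsupport_subset {G : E4 → Fin 4 → Fin 4 → ℝ} {V : Set E4}
    (hV : IsOpen V) (hG : ∀ μ ν, ContDiffOn ℝ ∞ (fun x ↦ G x μ ν) V) {w : E4 → ℝ}
    (hw : ContDiff ℝ ∞ w) (hws : tsupport w ⊆ V) : Continuous (waveOperator G w) := by
  have hinner : ∀ μ, ContDiffOn ℝ ∞ (fun y ↦ ∑ ν, G y μ ν * fderiv ℝ w y (E4.basisVector ν)) V :=
    fun μ ↦ ContDiffOn.sum fun ν _ ↦ (hG μ ν).mul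
      (((hw.fderiv_right (m := ∞) le_rfl).clm_apply contDiff_const).contDiffOn)
  have hon : ContinuousOn (waveOperator G w) V := by
    have hfun : waveOperator G w = fun x ↦ ∑ μ, fderiv ℝ
        (fun y ↦ ∑ ν, G y μ ν * fderiv ℝ w y (E4.basisVector ν)) x (E4.basisVector μ) := rfl
    rw [hfun]
    refine continuousOn_finsetSum _ fun μ _ ↦ ?_
    exact ((hinner μ).continuousOn_fderiv_of_isOpen hV (by simp)).clm_apply continuousOn_const
  refine continuous_iff_continuousAt.2 fun x ↦ ?_
  by_cases hx : x ∈ V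
  · exact hon.continuousAt (hV.mem_nhds hx)
  · have hxs : x ∉ tsupport w := fun h ↦ hx (hws h)
    have hzero : ∀ᶠ y in 𝓝 x, waveOperator G w y = 0 := by
      filter_upwards [(isClosed_tsupport w).isOpen_compl.mem_nhds hxs] with y hy
      refine waveOperator_eq_zero_of_eventuallyEq_zero ?_
      filter_upwards [(isClosed_tsupport w).isOpen_compl.mem_nhds hy] with z hz
      exact image_eq_zero_of_notMem_tsupport hz
    refine (continuousAt_const (y := (0 : ℝ))).congr ?_
    filter_upwards [hzero] with y hy
    exact hy.symm

/-- **The wave operator commutes with constant factors** (for `w ∈ C^∞` supported inside the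
open set where the coefficients are differentiable). [folklore] -/
theorem waveOperator_const_mul_of_tsupport_subset {G : E4 → Fin 4 → Fin 4 → ℝ} {V : Set E4}
    (hV : IsOpen V) (hG : ∀ μ ν, ContDiffOn ℝ ∞ (fun x ↦ G x μ ν) V) {w : E4 → ℝ}
    (hw : ContDiff ℝ ∞ w) (hws : tsupport w ⊆ V) (s : ℝ) (x : E4) :
    waveOperator G (fun y ↦ s * w y) x = s * waveOperator G w x := by
  have hdw : ∀ y, fderiv ℝ (fun z ↦ s * w z) y = s • fderiv ℝ w y := fun y ↦ by
    have h := ((hw.differentiable (by simp)) y).hasFDerivAt.const_mul s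
    exact h.fderiv
  by_cases hx : x ∈ V
  · have hGd : ∀ μ ν, DifferentiableAt ℝ (fun y ↦ G y μ ν) x := fun μ ν ↦
      ((hG μ ν).contDiffAt (hV.mem_nhds hx)).differentiableAt (by simp)
    have hwd : ∀ ν, DifferentiableAt ℝ (fun y ↦ fderiv ℝ w y (E4.basisVector ν)) x := fun ν ↦
      (((hw.fderiv_right (m := ∞) le_rfl).clm_apply contDiff_const).differentiable (by simp)) x
    have hinner : ∀ μ, (fun y ↦ ∑ ν, G y μ ν * fderiv ℝ (fun z ↦ s * w z) y (E4.basisVector ν)) =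
        fun y ↦ s * ∑ ν, G y μ ν * fderiv ℝ w y (E4.basisVector ν) := by
      intro μ; funext y
      simp only [hdw, FunLike.coe_smul, Pi.smul_apply, smul_eq_mul, Finset.mul_sum]
      exact Finset.sum_congr rfl fun ν _ ↦ by ring
    unfold waveOperator
    rw [Finset.mul_sum]
    refine Finset.sum_congr rfl fun μ _ ↦ ?_
    rw [hinner μ]
    have hd : DifferentiableAt ℝ (fun y ↦ ∑ ν, G y μ ν * fderiv ℝ w y (E4.basisVector ν)) x :=
      DifferentiableAt.fun_sum fun ν _ ↦ (hGd μ ν).mul (hwd ν)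
    rw [fderiv_const_mul hd]
    rfl
  · have hxs : x ∉ tsupport w := fun h ↦ hx (hws h)
    have h1 : waveOperator G w x = 0 := by
      refine waveOperator_eq_zero_of_eventuallyEq_zero ?_
      filter_upwards [(isClosed_tsupport w).isOpen_compl.mem_nhds hxs] with z hz
      exact image_eq_zero_of_notMem_tsupport hz
    have h2 : waveOperator G (fun y ↦ s * w y) x = 0 := by
      refine waveOperator_eq_zero_of_eventuallyEq_zero ?_
      filter_upwards [(isClosed_tsupport w).isOpen_compl.mem_nhds hxs] with z hz
      simp [image_eq_zero_of_notMem_tsupport hz]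
    rw [h1, h2, mul_zero]

/-- **The energy density scales quadratically**: `P⁰[s w] = s² P⁰[w]` for differentiable `w`.
[folklore] -/
theorem normalCurrent_const_mul {G : E4 → Fin 4 → Fin 4 → ℝ} {w : E4 → ℝ} (hw : Differentiable ℝ w)
    (s : ℝ) (x : E4) (μ : Fin 4) :
    normalCurrent G (fun y ↦ s * w y) x μ = s ^ 2 * normalCurrent G w x μ := by
  have hd : fderiv ℝ (fun z ↦ s * w z) x = s • fderiv ℝ w x := ((hw x).hasFDerivAt.const_mul s).fderiv
  simp only [normalCurrent, hd, FunLike.coe_smul, Pi.smul_apply, smul_eq_mul]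
  simp only [Finset.mul_sum]
  have e1 : ∀ ν, G x μ ν * (s * fderiv ℝ w x (E4.basisVector ν)) = s * (G x μ ν * fderiv ℝ w x (E4.basisVector ν)) :=
    fun ν ↦ by ring
  have e2 : ∀ ν, G x 0 ν * (s * fderiv ℝ w x (E4.basisVector ν)) = s * (G x 0 ν * fderiv ℝ w x (E4.basisVector ν)) :=
    fun ν ↦ by ring
  have e3 : ∀ α β, G x α β * (s * fderiv ℝ w x (E4.basisVector α)) * (s * fderiv ℝ w x (E4.basisVector β)) =
      s ^ 2 * (G x α β * fderiv ℝ w x (E4.basisVector α) * fderiv ℝ w x (E4.basisVector β)) :=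
    fun α β ↦ by ring
  simp only [e1, e2, e3, ← Finset.mul_sum]
  ring

/-- **The energy density is continuous** for `w ∈ C^∞` supported inside the open set where the
coefficients are smooth. [folklore] -/
theorem continuous_normalCurrent_of_tsupport_subset {G : E4 → Fin 4 → Fin 4 → ℝ} {V : Set E4}
    (hV : IsOpen V) (hG : ∀ μ ν, ContDiffOn ℝ ∞ (fun x ↦ G x μ ν) V) {w : E4 → ℝ}
    (hw : ContDiff ℝ ∞ w) (hws : tsupport w ⊆ V) (μ : Fin 4) :
    Continuous fun x ↦ normalCurrent G w x μ := by
  have hd : ∀ ν, Continuous fun x ↦ fderiv ℝ w x (E4.basisVector ν) := fun ν ↦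
    ((hw.continuous_fderiv (by simp)).clm_apply continuous_const)
  have hon : ContinuousOn (fun x ↦ normalCurrent G w x μ) V := by
    unfold normalCurrent
    refine ContinuousOn.sub (ContinuousOn.mul ?_ ?_) (ContinuousOn.mul ?_ ?_)
    · exact continuousOn_finsetSum _ fun ν _ ↦ (hG μ ν).continuousOn.mul (hd ν).continuousOn
    · exact continuousOn_finsetSum _ fun ν _ ↦ (hG 0 ν).continuousOn.mul (hd ν).continuousOn
    · exact continuousOn_const.mul (hG 0 μ).continuousOn
    · exact continuousOn_finsetSum _ fun α _ ↦ continuousOn_finsetSum _ fun β _ ↦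
        ((hG α β).continuousOn.mul (hd α).continuousOn).mul (hd β).continuousOn
  refine continuous_iff_continuousAt.2 fun x ↦ ?_
  by_cases hx : x ∈ V
  · exact hon.continuousAt (hV.mem_nhds hx)
  · have hxs : x ∉ tsupport w := fun h ↦ hx (hws h)
    have hzero : ∀ᶠ y in 𝓝 x, normalCurrent G w y μ = 0 := by
      filter_upwards [(isClosed_tsupport w).isOpen_compl.mem_nhds hxs] with y hy
      have hwz : w =ᶠ[𝓝 y] fun _ ↦ 0 := by
        filter_upwards [(isClosed_tsupport w).isOpen_compl.mem_nhds hy] with z hz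
        exact image_eq_zero_of_notMem_tsupport hz
      have hfd : fderiv ℝ w y = 0 := by rw [hwz.fderiv_eq]; exact fderiv_const_apply 0
      simp [normalCurrent, hfd]
    refine (continuousAt_const (y := (0 : ℝ))).congr ?_
    filter_upwards [hzero] with y hy
    exact hy.symm

/-- The energy density vanishes off the support. [folklore] -/
theorem normalCurrent_eq_zero_of_notMem_tsupport {G : E4 → Fin 4 → Fin 4 → ℝ} {w : E4 → ℝ} {x : E4}
    (hx : x ∉ tsupport w) (μ : Fin 4) : normalCurrent G w x μ = 0 := by
  have hzero : w =ᶠ[𝓝 x] fun _ ↦ 0 := by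
    filter_upwards [(isClosed_tsupport w).isOpen_compl.mem_nhds hx] with y hy
    exact image_eq_zero_of_notMem_tsupport hy
  have hfd : fderiv ℝ w x = 0 := by rw [hzero.fderiv_eq]; exact fderiv_const_apply 0
  simp [normalCurrent, hfd]

/-- The energy density of a compactly supported function has compact support. [folklore] -/
theorem hasCompactSupport_normalCurrent {G : E4 → Fin 4 → Fin 4 → ℝ} {w : E4 → ℝ}
    (hc : HasCompactSupport w) (μ : Fin 4) : HasCompactSupport fun x ↦ normalCurrent G w x μ :=
  IsCompact.of_isClosed_subset hc (isClosed_tsupport _)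
    (closure_minimal (fun x hx ↦ by by_contra h; exact hx (normalCurrent_eq_zero_of_notMem_tsupport h μ))
      (isClosed_tsupport _))

namespace BeamAmp

variable {G : E4 → Fin 4 → Fin 4 → ℝ} {V : Set E4} {J : Set ℝ} {D : BeamData G V J} {T : ℝ}
  (A : BeamAmp D T)

/-- The support of the real beam lies in `V`. [folklore] -/
theorem tsupport_beam_subset_V (lam : ℝ) : tsupport (A.beam lam) ⊆ V :=
  (A.tsupport_beam_subset lam).trans A.tsupp_V

/-- `□_G` of the real beam is continuous on the chart. [folklore] -/
theorem continuous_waveOperator_beam (lam : ℝ) : Continuous (waveOperator G (A.beam lam)) :=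
  continuous_waveOperator_of_tsupport_subset D.hV D.hG (A.contDiff_beam lam) (A.tsupport_beam_subset_V lam)

/-- `□_G (s · beam) = s □_G beam`. [folklore] -/
theorem waveOperator_const_mul_beam (lam s : ℝ) (x : E4) :
    waveOperator G (fun y ↦ s * A.beam lam y) x = s * waveOperator G (A.beam lam) x :=
  waveOperator_const_mul_of_tsupport_subset D.hV D.hG (A.contDiff_beam lam) (A.tsupport_beam_subset_V lam) s x

/-- **The slab bound for the scaled beam**, as a statement about the lifted function on
`ℝ × E3`: `∫_{[0,T]×E3} (□_G (s·beam))² = s² ∫ (□_G beam)² ≤ s² C`. [cite: Sbierski2015, §2 (proof of Thm. 2.1, (2.4) after normalisation)] -/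
theorem setIntegral_sq_waveOperator_const_mul_beam_le {C : ℝ}
    (hC : ∀ lam : ℝ, 1 ≤ lam → ∫ p in Icc (0 : ℝ) T ×ˢ (univ : Set E3),
      waveOperator G (A.beam lam) (E4.ofTimeSpace p.1 p.2) ^ 2 ≤ C)
    {lam : ℝ} (hlam : 1 ≤ lam) (s : ℝ) :
    ∫ p in Icc (0 : ℝ) T ×ˢ (univ : Set E3),
      waveOperator G (fun y ↦ s * A.beam lam y) (E4.ofTimeSpace p.1 p.2) ^ 2 ≤ s ^ 2 * C := by
  simp only [A.waveOperator_const_mul_beam lam s, mul_pow]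
  rw [integral_const_mul]
  exact mul_le_mul_of_nonneg_left (hC lam hlam) (sq_nonneg s)

end BeamAmp

end GaussianBeam

end Literature.Geometry.Lorentzian
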